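import Mathlib
import HarnessLib
import Summits.MatrixMultiplication.MatrixMultiplication.Theorems.OutsiderSandwichToricCeiling
import Summits.MatrixMultiplication.MatrixMultiplication.Theorems.OutsiderSandwichToricCeilingMixed

/-!
# OutsiderSandwich — the toric ceiling `7 = 3² - 2` IS attained in the MIXED product bases
`cw ⊠ D` and `D ⊠ cw` of `cw₂^{⊠2}` (decomp-mm lens 4, gen 46, kernel K46-1; THESES-FREE, `ω`-free;
TORIC · `N = 2` · NEC-side instrument toward `LaserTangency`, stmt-32268 — it does not touch the
route's cut or the rates of `LaserTangency`)

WHAT.  The four product bases `{cw, D} × {cw, D}` of the literal host `kroneckerPow (cwTensor ℂ 2) 2`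
have support frames `cwFrame`, `mixedFrame`, `swappedFrame`, `tightFrame` (36 triples each).  The tree
knows: no diagonal combinatorial degeneration (Bürgisser–Clausen–Shokrollahi (15.29)) of size `≥ 8`
in any of them (K43-1 `…ToricCeiling`, K43-3 `…ToricCeilingMixed`), size `7` attained in `cwFrame`
(`cwFrame_toric_value`), and toric value exactly `6` in `tightFrame` (K44-2 `…TightSeven`).  This file
settles the two mixed bases:

* `mixedFrame_diagonal_comb_degeneration_seven`: the explicit diagonal `psiSevenMixed` (7 triples)
  with integer weights in `[-4, 5]` is a combinatorial degeneration of `mixedFrame`;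
* `swappedFrame_diagonal_comb_degeneration_seven`: its coordinate swap is one of `swappedFrame`;
* `mixedFrame_toric_value`, `swappedFrame_toric_value`: the toric value of BOTH mixed bases is
  EXACTLY `7`.

CONSEQUENCE FOR THE LENS-4 LADDER (memo NODE-g46).  The `N = 2` toric table by product basis is
`cw⊠cw : 7`, `cw⊠D : 7`, `D⊠cw : 7`, `D⊠D : 6`.  Hence the tentative all-basis sharpening
"`#Ψ ≤ 3^N - 3` for every product basis `κ ≠ cw^N`" (NODE-g44 C1) is FALSE at `N = 2`: the hypothesis
"all coordinates in the permutation pattern" of K45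
(`…ToricCeilingPowSubTwo.tightFrame_pow_no_diagonal_comb_degeneration_sub_two`) is exactly right at
`N = 2`, and any mixed-basis sharpening must assume `N ≥ 3` (or at least two `D` coordinates).

DATA (exact rational LP, pure Python, in-seat; not formalised beyond the certificate): of the `2088`
size-7 diagonals of `mixedFrame`, `504` are combinatorial degenerations — precisely the admissible
co-size-2 complements carrying a UNIQUE perfect matching (cf. K43-5 `…ToricUniqueness`).  For the
`Ψ` below the LP optimum of `max |weight|` over rational certificates is `47/12`, so no integer
certificate with entries in `[-3, 3]` exists for it; `[-4, 5]` is what a short search found.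

Kernel `decide` needs `maxRecDepth 100000` (as in K43-1); no compiled evaluation, no new axioms.
-/

set_option linter.dupNamespace false

namespace Summit.MatrixMultiplication.MatrixMultiplication.Theorems.OutsiderSandwichToricCeilingMixedSeven

open Finset
open Summit.MatrixMultiplication.MatrixMultiplication.Theorems.OutsiderSandwichToricCeiling
  (Pt Tr cwSlot dSlot isDiagonal)
open Summit.MatrixMultiplication.MatrixMultiplication.Theorems.OutsiderSandwichToricCeilingMixed
  (mixedFrame swappedFrame mixedFrame_no_diagonal_comb_degeneration_eight
    swappedFrame_no_diagonal_comb_degeneration_eight)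

set_option maxRecDepth 100000

/-! ## §1 The mixed frame `cw ⊠ D` (coordinate 1 = cw letter, coordinate 2 = permutation letter) -/

/-- A size-7 diagonal of the mixed frame: the unique perfect matching of the complement of the
missing pairs `X = {(0,0),(1,1)}`, `Y = {(0,1),(2,2)}`, `Z = {(2,0),(2,2)}`. [new] -/
def psiSevenMixed : Finset Tr :=
  {((0,1), (1,0), (1,2)), ((0,2), (1,1), (1,0)), ((1,0), (1,2), (0,1)), ((1,2), (0,0), (1,1)),
    ((2,0), (0,2), (2,1)), ((2,1), (2,0), (0,2)), ((2,2), (2,1), (0,0))}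

/-- Leg-1 weights of the mixed size-7 certificate (rows = cw letter, columns = D letter; entries in
`[-4, 4]`). [new] -/
def aSevenMixed : Pt → ℤ := fun p => !![4, 3, 0; 0, 4, -1; -1, -4, 0] p.1 p.2

/-- Leg-2 weights of the mixed size-7 certificate. [new] -/
def bSevenMixed : Pt → ℤ := fun p => !![0, 4, 0; 0, 0, -2; 0, -2, 4] p.1 p.2

/-- Leg-3 weights of the mixed size-7 certificate (entries in `[-3, 5]`). [new] -/
def cSevenMixed : Pt → ℤ := fun p => !![2, 2, 4; 0, 1, -3; 5, 1, 5] p.1 p.2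

/-- **The mixed-frame ceiling `7` is attained**: `psiSevenMixed` with the weights above is a size-7
diagonal combinatorial degeneration of `mixedFrame` (TORIC, `N = 2`). [new] -/
theorem mixedFrame_diagonal_comb_degeneration_seven :
    psiSevenMixed ⊆ mixedFrame ∧
      (∀ t ∈ psiSevenMixed, aSevenMixed t.1 + bSevenMixed t.2.1 + cSevenMixed t.2.2 = 0) ∧
      (∀ t ∈ mixedFrame, t ∉ psiSevenMixed →
        1 ≤ aSevenMixed t.1 + bSevenMixed t.2.1 + cSevenMixed t.2.2) ∧
      isDiagonal psiSevenMixed = true ∧ #psiSevenMixed = 7 := by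
  refine ⟨by decide +kernel, by decide +kernel, by decide +kernel, by decide +kernel, by decide +kernel⟩

/-- **The toric value of the mixed frame `cw ⊠ D` is exactly `7`**: a size-7 diagonal combinatorial
degeneration exists and none of size `≥ 8` does (K43-3). [new] -/
theorem mixedFrame_toric_value :
    (∃ Ψ : Finset Tr, ∃ a b c : Pt → ℤ, Ψ ⊆ mixedFrame ∧ (∀ t ∈ Ψ, a t.1 + b t.2.1 + c t.2.2 = 0) ∧
      (∀ t ∈ mixedFrame, t ∉ Ψ → 1 ≤ a t.1 + b t.2.1 + c t.2.2) ∧ isDiagonal Ψ = true ∧ #Ψ = 7) ∧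
    ¬ (∃ Ψ : Finset Tr, ∃ a b c : Pt → ℤ, Ψ ⊆ mixedFrame ∧ (∀ t ∈ Ψ, a t.1 + b t.2.1 + c t.2.2 = 0) ∧
      (∀ t ∈ mixedFrame, t ∉ Ψ → 1 ≤ a t.1 + b t.2.1 + c t.2.2) ∧ isDiagonal Ψ = true ∧ 8 ≤ #Ψ) :=
  ⟨⟨psiSevenMixed, aSevenMixed, bSevenMixed, cSevenMixed,
      mixedFrame_diagonal_comb_degeneration_seven⟩,
    fun ⟨_, _, _, _, hsub, hzero, hone, hdiag, h8⟩ =>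
      mixedFrame_no_diagonal_comb_degeneration_eight hsub hzero hone hdiag h8⟩

/-! ## §2 The swapped frame `D ⊠ cw` (coordinate swap of §1) -/

/-- The coordinate swap of `psiSevenMixed`: a size-7 diagonal of `swappedFrame`. [new] -/
def psiSevenSwapped : Finset Tr :=
  {((0,1), (2,1), (1,0)), ((0,2), (2,0), (1,2)), ((1,0), (0,1), (2,1)), ((1,2), (0,2), (2,0)),
    ((2,0), (1,1), (0,1)), ((2,1), (0,0), (1,1)), ((2,2), (1,2), (0,0))}

/-- Leg-1 weights of the swapped certificate (transpose of `aSevenMixed`). [new] -/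
def aSevenSwapped : Pt → ℤ := fun p => aSevenMixed (p.2, p.1)

/-- Leg-2 weights of the swapped certificate (transpose of `bSevenMixed`). [new] -/
def bSevenSwapped : Pt → ℤ := fun p => bSevenMixed (p.2, p.1)

/-- Leg-3 weights of the swapped certificate (transpose of `cSevenMixed`). [new] -/
def cSevenSwapped : Pt → ℤ := fun p => cSevenMixed (p.2, p.1)

/-- **The swapped-frame ceiling `7` is attained** (TORIC, `N = 2`). [new] -/
theorem swappedFrame_diagonal_comb_degeneration_seven :
    psiSevenSwapped ⊆ swappedFrame ∧
      (∀ t ∈ psiSevenSwapped, aSevenSwapped t.1 + bSevenSwapped t.2.1 + cSevenSwapped t.2.2 = 0) ∧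
      (∀ t ∈ swappedFrame, t ∉ psiSevenSwapped →
        1 ≤ aSevenSwapped t.1 + bSevenSwapped t.2.1 + cSevenSwapped t.2.2) ∧
      isDiagonal psiSevenSwapped = true ∧ #psiSevenSwapped = 7 := by
  refine ⟨by decide +kernel, by decide +kernel, by decide +kernel, by decide +kernel, by decide +kernel⟩

/-- **The toric value of the swapped frame `D ⊠ cw` is exactly `7`.** [new] -/
theorem swappedFrame_toric_value :
    (∃ Ψ : Finset Tr, ∃ a b c : Pt → ℤ, Ψ ⊆ swappedFrame ∧ (∀ t ∈ Ψ, a t.1 + b t.2.1 + c t.2.2 = 0) ∧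
      (∀ t ∈ swappedFrame, t ∉ Ψ → 1 ≤ a t.1 + b t.2.1 + c t.2.2) ∧ isDiagonal Ψ = true ∧
      #Ψ = 7) ∧
    ¬ (∃ Ψ : Finset Tr, ∃ a b c : Pt → ℤ, Ψ ⊆ swappedFrame ∧
      (∀ t ∈ Ψ, a t.1 + b t.2.1 + c t.2.2 = 0) ∧
      (∀ t ∈ swappedFrame, t ∉ Ψ → 1 ≤ a t.1 + b t.2.1 + c t.2.2) ∧ isDiagonal Ψ = true ∧
      8 ≤ #Ψ) :=
  ⟨⟨psiSevenSwapped, aSevenSwapped, bSevenSwapped, cSevenSwapped,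
      swappedFrame_diagonal_comb_degeneration_seven⟩,
    fun ⟨_, _, _, _, hsub, hzero, hone, hdiag, h8⟩ =>
      swappedFrame_no_diagonal_comb_degeneration_eight hsub hzero hone hdiag h8⟩

end Summit.MatrixMultiplication.MatrixMultiplication.Theorems.OutsiderSandwichToricCeilingMixedSeven
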